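import Mathlib
import Literature.Probability.LatticeModels.TorusFourierWeightedL1
import Literature.Probability.LatticeModels.TorusFourierWeightedL1ProdMoment
import HarnessLib

/-!
# Position MOMENTS of order `r` of an inverse torus Fourier transform on `(ℤ/Lℤ)²` from sup laws on the mixed differences of orders `≤ r + 2`

Topic `Probability/LatticeModels`; sequel of `TorusFourierWeightedL1` (weighted Plancherel in ONE direction: `Σ_x (4|x̃_v|/L)^{2N}‖Σ_k χ_k(x)h(k)‖² ≤
L^d Σ_k‖Δ_v^N h(k)‖²`) and `TorusFourierWeightedL1ProdMoment` (`Σ_b Π_i(1+(b̃_i/R)²)⁻¹ ≤ 36R²`).  For momentum data `f` on the dual torus `(ℤ/Lℤ)²`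
and its NORMALISED inverse transform `f̌(x) = L⁻²Σ_k f(k)χ_k(x)` (`torusFourierInv`), the weighted `ℓ¹` norm with the submultiplicative moment weight
`(1 + |x̃₀| + |x̃₁|)^r` — the quantity that controls the `r`-th derivatives of the trigonometric interpolant of `f` and that multiplies under
products of data (`TorusFourierWeightedConvolution`) — is bounded by SUP laws on the MIXED differences `Δ_{e₁}^bΔ_{e₀}^a f` of total order
`a + b ≤ r + 2` (Benfatto–Giuliani–Mastropietro 2006, (2.36aa)/(3.3): moments of a lattice kernel ↔ discrete smoothness of its symbol; here in
the `L`-uniform normalisation `(L/4)^{a+b}·sup_k‖Δ^{(a,b)}f(k)‖`, which for the samples of a smooth `2π`-periodic symbol is `≤ (π/2)^{a+b}·sup‖D^{a+b}‖`):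

* `sum_mixedMonomial_mul_norm_sq_torusFourierInv_le` — the two-direction weighted Plancherel in the normalised form
  `Σ_x |x̃₀|^{2a}|x̃₁|^{2b}‖f̌(x)‖² ≤ (L/4)^{2(a+b)}·L⁻²·Σ_k‖Δ_{e₁}^bΔ_{e₀}^a f(k)‖²`, and its sup form `…_le_sq` (`≤ 𝒥²` when
  `(L/4)^{a+b}‖Δ_{e₁}^bΔ_{e₀}^a f(k)‖ ≤ 𝒥` for all `k`);
* `one_add_add_pow_two_mul_le` — `(1+s+t)^{2r} ≤ 9^r·(1 + s^{2r} + t^{2r})` (`s, t ≥ 0`);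
* **`sum_momentWeight_mul_norm_torusFourierInv_le`** — if `(L/4)^{a+b}·‖Δ_{e₁}^bΔ_{e₀}^a f(k)‖ ≤ 𝒥` for all `k` and all `a + b ≤ r + 2`, then
  `Σ_x (1+|x̃₀|+|x̃₁|)^r ‖f̌(x)‖ ≤ 21·3^r·𝒥` (Cauchy–Schwarz against `(1+x̃₀²)(1+x̃₁²)`, twelve mixed monomials of total order `≤ r + 2`).

Everything is proved; no definitions; no named facts.

## Sources

G. Benfatto, A. Giuliani, V. Mastropietro, Ann. Henri Poincaré 7 (2006) 809–898, Lemma 2.2, (2.36aa), §3 (3.3) (`BenfattoGiulianiMastropietro2006`);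
S. Friedli, Y. Velenik, *Statistical Mechanics of Lattice Systems* (2017), §10.4 (`FriedliVelenik2017`).
-/

noncomputable section

open Finset Complex
open scoped ComplexConjugate

namespace Literature.Probability.LatticeModels

variable {L : ℕ} [NeZero L]

/-! ### §1 The two-direction weighted Plancherel in the normalised form -/

omit [NeZero L] in
/-- `Σ_j (e_l)_j x_j = x_l` for the unit vector `e_l = Pi.single l 1`. [cite: FriedliVelenik2017, §10.4] -/
theorem sum_single_mul_apply (l : Fin 2) (x : TorusSite 2 L) : ∑ j, (Pi.single l (1 : ZMod L) : TorusSite 2 L) j * x j = x l := by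
  simp [Pi.single_apply]

/-- `‖f̌(x)‖ = L⁻²·‖Σ_k χ_k(x) f(k)‖` on `(ℤ/Lℤ)²`. [cite: FriedliVelenik2017, §10.4] -/
theorem norm_torusFourierInv_eq (f : TorusSite 2 L → ℂ) (x : TorusSite 2 L) :
    ‖torusFourierInv f x‖ = ((L : ℝ) ^ 2)⁻¹ * ‖∑ k, torusChar k x * f k‖ := by
  rw [torusFourierInv_eq_sum_torusChar, show (∑ k, f k * torusChar k x) = ∑ k, torusChar k x * f k from
    sum_congr rfl fun k _ => mul_comm _ _, norm_mul, norm_inv, norm_pow, Complex.norm_natCast]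

/-- **Two-direction weighted Plancherel, normalised**: `Σ_x |x̃₀|^{2a}|x̃₁|^{2b}‖f̌(x)‖² ≤ (L/4)^{2(a+b)}·L⁻²·Σ_k ‖Δ_{e₁}^bΔ_{e₀}^a f(k)‖²`
(`a` differences in the direction `e₀` buy `|x̃₀|^a` by the chord bound `4|x̃₀|/L ≤ ‖χ_{e₀}(x) − 1‖`, then the one-direction weighted Plancherel in `e₁`).
[cite: BenfattoGiulianiMastropietro2006, Lemma 2.2 and (2.36aa)] -/
theorem sum_mixedMonomial_mul_norm_sq_torusFourierInv_le (f : TorusSite 2 L → ℂ) (a b : ℕ) :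
    ∑ x : TorusSite 2 L, |((x 0).valMinAbs : ℝ)| ^ (2 * a) * |((x 1).valMinAbs : ℝ)| ^ (2 * b) * ‖torusFourierInv f x‖ ^ 2 ≤
      ((L : ℝ) / 4) ^ (2 * (a + b)) * (((L : ℝ) ^ 2)⁻¹ *
        ∑ k, ‖((fwdDiff (Pi.single 1 (1 : ZMod L) : TorusSite 2 L))^[b]
          ((fwdDiff (Pi.single 0 (1 : ZMod L) : TorusSite 2 L))^[a] f)) k‖ ^ 2) := by
  have hL : (0 : ℝ) < L := Nat.cast_pos.2 (Nat.pos_of_ne_zero (NeZero.ne L))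
  set e₀ : TorusSite 2 L := Pi.single 0 (1 : ZMod L) with he₀
  set e₁ : TorusSite 2 L := Pi.single 1 (1 : ZMod L) with he₁
  set h : TorusSite 2 L → ℂ := (fwdDiff e₀)^[a] f with hh
  -- the one-direction weighted Plancherel for `h` in the direction `e₁`
  have hP := sum_weight_mul_norm_sq_le (d := 2) h e₁ b
  have hw1 : ∀ x : TorusSite 2 L, (4 * |((∑ j, e₁ j * x j).valMinAbs : ℝ)| / L) = 4 * |((x 1).valMinAbs : ℝ)| / L := fun x => by
    rw [he₁, sum_single_mul_apply]
  simp_rw [hw1] at hP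
  -- the `a` differences in the direction `e₀` as a pointwise weight
  have hpt : ∀ x : TorusSite 2 L, (4 * |((x 0).valMinAbs : ℝ)| / L) ^ a * ‖∑ k, torusChar k x * f k‖ ≤ ‖∑ k, torusChar k x * h k‖ := by
    intro x
    have hid : ∑ k, torusChar k x * h k = (conj (torusChar e₀ x) - 1) ^ a * ∑ k, torusChar k x * f k := by
      have := sum_torusChar_smul_fwdDiff_iter (E := ℂ) e₀ x a f
      simpa only [smul_eq_mul, hh] using this
    have hconj : ‖conj (torusChar e₀ x) - 1‖ = ‖torusChar e₀ x - 1‖ := by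
      rw [show conj (torusChar e₀ x) - 1 = conj (torusChar e₀ x - 1) by rw [map_sub, map_one], Complex.norm_conj]
    have hch : 4 * |((x 0).valMinAbs : ℝ)| / L ≤ ‖torusChar e₀ x - 1‖ := by
      have h0 := le_norm_torusChar_sub_one e₀ x
      rwa [he₀, sum_single_mul_apply] at h0
    rw [hid, norm_mul, norm_pow, hconj]
    exact mul_le_mul_of_nonneg_right (pow_le_pow_left₀ (by positivity) hch a) (norm_nonneg _)
  -- combine
  have hmain : ∑ x : TorusSite 2 L, (4 * |((x 0).valMinAbs : ℝ)| / L) ^ (2 * a) * (4 * |((x 1).valMinAbs : ℝ)| / L) ^ (2 * b) *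
      ‖∑ k, torusChar k x * f k‖ ^ 2 ≤ (L : ℝ) ^ 2 * ∑ k, ‖((fwdDiff e₁)^[b] h) k‖ ^ 2 := by
    refine le_trans (sum_le_sum fun x _ => ?_) hP
    have h0 : 0 ≤ (4 * |((x 0).valMinAbs : ℝ)| / L) ^ a * ‖∑ k, torusChar k x * f k‖ := by positivity
    calc (4 * |((x 0).valMinAbs : ℝ)| / L) ^ (2 * a) * (4 * |((x 1).valMinAbs : ℝ)| / L) ^ (2 * b) * ‖∑ k, torusChar k x * f k‖ ^ 2
        = (4 * |((x 1).valMinAbs : ℝ)| / L) ^ (2 * b) * ((4 * |((x 0).valMinAbs : ℝ)| / L) ^ a * ‖∑ k, torusChar k x * f k‖) ^ 2 := by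
          rw [mul_comm 2 a, pow_mul]; ring
      _ ≤ (4 * |((x 1).valMinAbs : ℝ)| / L) ^ (2 * b) * ‖∑ k, torusChar k x * h k‖ ^ 2 :=
          mul_le_mul_of_nonneg_left (pow_le_pow_left₀ h0 (hpt x) 2) (by positivity)
  -- normalisation
  have hnorm : ∀ x : TorusSite 2 L, |((x 0).valMinAbs : ℝ)| ^ (2 * a) * |((x 1).valMinAbs : ℝ)| ^ (2 * b) * ‖torusFourierInv f x‖ ^ 2 =
      ((L : ℝ) / 4) ^ (2 * (a + b)) * ((L : ℝ) ^ 2)⁻¹ ^ 2 *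
        ((4 * |((x 0).valMinAbs : ℝ)| / L) ^ (2 * a) * (4 * |((x 1).valMinAbs : ℝ)| / L) ^ (2 * b) * ‖∑ k, torusChar k x * f k‖ ^ 2) := by
    intro x
    have hL0 : (L : ℝ) ≠ 0 := hL.ne'
    have h1 : ∀ (y : ℝ) (n : ℕ), ((L : ℝ) / 4) ^ n * (4 * y / L) ^ n = y ^ n := fun y n => by
      rw [← mul_pow]; congr 1; field_simp
    rw [norm_torusFourierInv_eq, mul_pow, ← h1 (|((x 0).valMinAbs : ℝ)|) (2 * a), ← h1 (|((x 1).valMinAbs : ℝ)|) (2 * b),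
      show 2 * (a + b) = 2 * a + 2 * b by ring, pow_add]
    ring
  simp_rw [hnorm]
  rw [← mul_sum]
  calc ((L : ℝ) / 4) ^ (2 * (a + b)) * ((L : ℝ) ^ 2)⁻¹ ^ 2 *
        ∑ x : TorusSite 2 L, (4 * |((x 0).valMinAbs : ℝ)| / L) ^ (2 * a) * (4 * |((x 1).valMinAbs : ℝ)| / L) ^ (2 * b) * ‖∑ k, torusChar k x * f k‖ ^ 2
      ≤ ((L : ℝ) / 4) ^ (2 * (a + b)) * ((L : ℝ) ^ 2)⁻¹ ^ 2 * ((L : ℝ) ^ 2 * ∑ k, ‖((fwdDiff e₁)^[b] h) k‖ ^ 2) :=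
        mul_le_mul_of_nonneg_left hmain (by positivity)
    _ = ((L : ℝ) / 4) ^ (2 * (a + b)) * (((L : ℝ) ^ 2)⁻¹ * ∑ k, ‖((fwdDiff e₁)^[b] h) k‖ ^ 2) := by
        have hL0 : (L : ℝ) ^ 2 ≠ 0 := by positivity
        field_simp

/-- **Sup form**: if `(L/4)^{a+b}·‖Δ_{e₁}^bΔ_{e₀}^a f(k)‖ ≤ 𝒥` for every `k`, then `Σ_x |x̃₀|^{2a}|x̃₁|^{2b}‖f̌(x)‖² ≤ 𝒥²`.
[cite: BenfattoGiulianiMastropietro2006, Lemma 2.2 and (2.36aa)] -/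
theorem sum_mixedMonomial_mul_norm_sq_torusFourierInv_le_sq (f : TorusSite 2 L → ℂ) (a b : ℕ) {J : ℝ}
    (hJ : ∀ k, ((L : ℝ) / 4) ^ (a + b) * ‖((fwdDiff (Pi.single 1 (1 : ZMod L) : TorusSite 2 L))^[b]
      ((fwdDiff (Pi.single 0 (1 : ZMod L) : TorusSite 2 L))^[a] f)) k‖ ≤ J) :
    ∑ x : TorusSite 2 L, |((x 0).valMinAbs : ℝ)| ^ (2 * a) * |((x 1).valMinAbs : ℝ)| ^ (2 * b) * ‖torusFourierInv f x‖ ^ 2 ≤ J ^ 2 := by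
  have hL : (0 : ℝ) < L := Nat.cast_pos.2 (Nat.pos_of_ne_zero (NeZero.ne L))
  refine (sum_mixedMonomial_mul_norm_sq_torusFourierInv_le f a b).trans ?_
  have hcard : (Fintype.card (TorusSite 2 L) : ℝ) = (L : ℝ) ^ 2 := by
    rw [show Fintype.card (TorusSite 2 L) = L ^ 2 by simp [TorusSite, ZMod.card]]; push_cast; rfl
  have hterm : ∀ k, ((L : ℝ) / 4) ^ (2 * (a + b)) * ‖((fwdDiff (Pi.single 1 (1 : ZMod L) : TorusSite 2 L))^[b]
      ((fwdDiff (Pi.single 0 (1 : ZMod L) : TorusSite 2 L))^[a] f)) k‖ ^ 2 ≤ J ^ 2 := fun k => by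
    have h0 : 0 ≤ ((L : ℝ) / 4) ^ (a + b) * ‖((fwdDiff (Pi.single 1 (1 : ZMod L) : TorusSite 2 L))^[b]
      ((fwdDiff (Pi.single 0 (1 : ZMod L) : TorusSite 2 L))^[a] f)) k‖ := by positivity
    rw [show 2 * (a + b) = (a + b) * 2 by ring, pow_mul, ← mul_pow]
    exact pow_le_pow_left₀ h0 (hJ k) 2
  calc ((L : ℝ) / 4) ^ (2 * (a + b)) * (((L : ℝ) ^ 2)⁻¹ * ∑ k, ‖((fwdDiff (Pi.single 1 (1 : ZMod L) : TorusSite 2 L))^[b]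
          ((fwdDiff (Pi.single 0 (1 : ZMod L) : TorusSite 2 L))^[a] f)) k‖ ^ 2)
      = ((L : ℝ) ^ 2)⁻¹ * ∑ k, ((L : ℝ) / 4) ^ (2 * (a + b)) * ‖((fwdDiff (Pi.single 1 (1 : ZMod L) : TorusSite 2 L))^[b]
          ((fwdDiff (Pi.single 0 (1 : ZMod L) : TorusSite 2 L))^[a] f)) k‖ ^ 2 := by rw [mul_left_comm, mul_sum]
    _ ≤ ((L : ℝ) ^ 2)⁻¹ * ∑ _k : TorusSite 2 L, J ^ 2 := mul_le_mul_of_nonneg_left (sum_le_sum fun k _ => hterm k) (by positivity)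
    _ = J ^ 2 := by
        rw [sum_const, card_univ, nsmul_eq_mul, hcard]
        field_simp

/-! ### §2 The weight algebra -/

/-- `(1 + s + t)^{2r} ≤ 9^r·(1 + s^{2r} + t^{2r})` for `s, t ≥ 0`. [cite: BenfattoGiulianiMastropietro2006, §3 (3.3)] -/
theorem one_add_add_pow_two_mul_le (r : ℕ) {s t : ℝ} (hs : 0 ≤ s) (ht : 0 ≤ t) :
    (1 + s + t) ^ (2 * r) ≤ 9 ^ r * (1 + s ^ (2 * r) + t ^ (2 * r)) := by
  set M : ℝ := max 1 (max s t) with hM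
  have hM1 : 1 ≤ M := le_max_left _ _
  have hsM : s ≤ M := (le_max_left _ _).trans (le_max_right _ _)
  have htM : t ≤ M := (le_max_right _ _).trans (le_max_right _ _)
  have h3 : 1 + s + t ≤ 3 * M := by linarith
  have hMpow : M ^ (2 * r) ≤ 1 + s ^ (2 * r) + t ^ (2 * r) := by
    rcases le_total s t with hst | hts
    · rcases le_total 1 t with h1t | ht1
      · have : M = t := by rw [hM, max_eq_right hst, max_eq_right h1t]
        rw [this]; nlinarith [pow_nonneg hs (2 * r)]
      · have : M = 1 := by rw [hM, max_eq_right hst, max_eq_left ht1]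
        rw [this, one_pow]; nlinarith [pow_nonneg hs (2 * r), pow_nonneg ht (2 * r)]
    · rcases le_total 1 s with h1s | hs1
      · have : M = s := by rw [hM, max_eq_left hts, max_eq_right h1s]
        rw [this]; nlinarith [pow_nonneg ht (2 * r)]
      · have : M = 1 := by rw [hM, max_eq_left hts, max_eq_left hs1]
        rw [this, one_pow]; nlinarith [pow_nonneg hs (2 * r), pow_nonneg ht (2 * r)]
  calc (1 + s + t) ^ (2 * r) ≤ (3 * M) ^ (2 * r) := pow_le_pow_left₀ (by positivity) h3 _
    _ = 9 ^ r * M ^ (2 * r) := by rw [mul_pow, pow_mul]; norm_num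
    _ ≤ 9 ^ r * (1 + s ^ (2 * r) + t ^ (2 * r)) := mul_le_mul_of_nonneg_left hMpow (by positivity)

/-- `Σ_x ((1+x̃₀²)(1+x̃₁²))⁻¹ ≤ 36` on `(ℤ/Lℤ)²`. [cite: BenfattoGiulianiMastropietro2006, Lemma 2.2 and footnote 1] -/
theorem sum_inv_prodWeight_le : ∑ x : TorusSite 2 L, ((1 + ((x 0).valMinAbs : ℝ) ^ 2) * (1 + ((x 1).valMinAbs : ℝ) ^ 2))⁻¹ ≤ 36 := by
  have h := sum_prod_inv_one_add_valMinAbs_div_sq_le (L := L) (R := 1) le_rfl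
  simp only [Nat.cast_one, div_one, one_pow, mul_one, Fin.prod_univ_two] at h
  refine le_trans (le_of_eq (sum_congr rfl fun x _ => ?_)) h
  rw [mul_inv]

omit [NeZero L] in
/-- Cauchy–Schwarz with a positive weight: `Σ_x u(x)·‖g(x)‖ ≤ √(Σ_x W⁻¹)·√(Σ_x W·u²·‖g‖²)` (`u ≥ 0`, `W > 0`).
[cite: BenfattoGiulianiMastropietro2006, Lemma 2.2 and footnote 1] -/
theorem sum_mul_norm_le_sqrt_mul_sqrt {ι : Type*} [Fintype ι] (u : ι → ℝ) (hu : ∀ x, 0 ≤ u x) (g : ι → ℂ) (W : ι → ℝ)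
    (hW : ∀ x, 0 < W x) :
    ∑ x, u x * ‖g x‖ ≤ Real.sqrt (∑ x, (W x)⁻¹) * Real.sqrt (∑ x, W x * (u x ^ 2 * ‖g x‖ ^ 2)) := by
  have hcs := sum_mul_sq_le_sq_mul_sq univ (fun x => Real.sqrt ((W x)⁻¹)) (fun x => Real.sqrt (W x) * (u x * ‖g x‖))
  have hprod : ∀ x ∈ (univ : Finset ι), Real.sqrt ((W x)⁻¹) * (Real.sqrt (W x) * (u x * ‖g x‖)) = u x * ‖g x‖ := by
    intro x _
    rw [← mul_assoc, Real.sqrt_inv, inv_mul_cancel₀ (Real.sqrt_ne_zero'.2 (hW x)), one_mul]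
  have h1 : ∀ x ∈ (univ : Finset ι), Real.sqrt ((W x)⁻¹) ^ 2 = (W x)⁻¹ := fun x _ => Real.sq_sqrt (inv_nonneg.2 (hW x).le)
  have h2 : ∀ x ∈ (univ : Finset ι), (Real.sqrt (W x) * (u x * ‖g x‖)) ^ 2 = W x * (u x ^ 2 * ‖g x‖ ^ 2) := fun x _ => by
    rw [mul_pow, mul_pow, Real.sq_sqrt (hW x).le]
  rw [sum_congr rfl hprod, sum_congr rfl h1, sum_congr rfl h2] at hcs
  have hA : 0 ≤ ∑ x, (W x)⁻¹ := sum_nonneg fun x _ => inv_nonneg.2 (hW x).le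
  have hB : 0 ≤ ∑ x, W x * (u x ^ 2 * ‖g x‖ ^ 2) := sum_nonneg fun x _ => by have := hW x; positivity
  have hS : 0 ≤ ∑ x, u x * ‖g x‖ := sum_nonneg fun x _ => mul_nonneg (hu x) (norm_nonneg _)
  rw [← Real.sqrt_mul hA, Real.le_sqrt hS (mul_nonneg hA hB)]
  exact hcs

/-! ### §3 The moment bound -/

/-- **Position moments of order `r` from the mixed difference laws of orders `≤ r + 2`**: if `(L/4)^{a+b}·‖Δ_{e₁}^bΔ_{e₀}^a f(k)‖ ≤ 𝒥` for every
`k` and every `a + b ≤ r + 2`, then `Σ_x (1+|x̃₀|+|x̃₁|)^r·‖f̌(x)‖ ≤ 21·3^r·𝒥`. [cite: BenfattoGiulianiMastropietro2006, Lemma 2.2, (2.36aa) and §3 (3.3)] -/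
theorem sum_momentWeight_mul_norm_torusFourierInv_le (r : ℕ) (f : TorusSite 2 L → ℂ) {J : ℝ}
    (hJ : ∀ a b, a + b ≤ r + 2 → ∀ k, ((L : ℝ) / 4) ^ (a + b) * ‖((fwdDiff (Pi.single 1 (1 : ZMod L) : TorusSite 2 L))^[b]
      ((fwdDiff (Pi.single 0 (1 : ZMod L) : TorusSite 2 L))^[a] f)) k‖ ≤ J) :
    ∑ x : TorusSite 2 L, (1 + ((x 0).valMinAbs.natAbs : ℝ) + ((x 1).valMinAbs.natAbs : ℝ)) ^ r * ‖torusFourierInv f x‖ ≤ 21 * 3 ^ r * J := by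
  have hJ0 : 0 ≤ J := le_trans (by positivity) (hJ 0 0 (by omega) 0)
  -- notation for the centred coordinates
  set s : TorusSite 2 L → ℝ := fun x => |((x 0).valMinAbs : ℝ)| with hs
  set t : TorusSite 2 L → ℝ := fun x => |((x 1).valMinAbs : ℝ)| with ht
  have hcast : ∀ x : TorusSite 2 L, (1 + ((x 0).valMinAbs.natAbs : ℝ) + ((x 1).valMinAbs.natAbs : ℝ)) = 1 + s x + t x := fun x => by
    simp only [hs, ht, Nat.cast_natAbs, Int.cast_abs]
  simp_rw [hcast]
  -- the monomial bounds
  have hM : ∀ a b, a + b ≤ r + 2 → ∑ x : TorusSite 2 L, s x ^ (2 * a) * t x ^ (2 * b) * ‖torusFourierInv f x‖ ^ 2 ≤ J ^ 2 :=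
    fun a b hab => sum_mixedMonomial_mul_norm_sq_torusFourierInv_le_sq f a b (hJ a b hab)
  -- Cauchy–Schwarz against `W = (1+s²)(1+t²)`
  set W : TorusSite 2 L → ℝ := fun x => (1 + s x ^ 2) * (1 + t x ^ 2) with hW
  have hWpos : ∀ x, 0 < W x := fun x => by rw [hW]; positivity
  have hCS := sum_mul_norm_le_sqrt_mul_sqrt (fun x => (1 + s x + t x) ^ r) (fun x => by positivity) (fun x => torusFourierInv f x) W hWpos
  have hWinv : ∑ x, (W x)⁻¹ ≤ 36 := by
    have h := sum_inv_prodWeight_le (L := L)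
    refine le_trans (le_of_eq (sum_congr rfl fun x _ => ?_)) h
    rw [hW, hs, ht]; simp only [sq_abs]
  -- the weighted `ℓ²` sum: twelve monomials
  have hexp : ∀ x : TorusSite 2 L, W x * (((1 + s x + t x) ^ r) ^ 2 * ‖torusFourierInv f x‖ ^ 2) ≤
      9 ^ r * ((s x ^ (2 * 0) * t x ^ (2 * 0) + s x ^ (2 * 1) * t x ^ (2 * 0) + s x ^ (2 * 0) * t x ^ (2 * 1) + s x ^ (2 * 1) * t x ^ (2 * 1)) +
        (s x ^ (2 * r) * t x ^ (2 * 0) + s x ^ (2 * (r + 1)) * t x ^ (2 * 0) + s x ^ (2 * r) * t x ^ (2 * 1) + s x ^ (2 * (r + 1)) * t x ^ (2 * 1)) +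
        (s x ^ (2 * 0) * t x ^ (2 * r) + s x ^ (2 * 1) * t x ^ (2 * r) + s x ^ (2 * 0) * t x ^ (2 * (r + 1)) + s x ^ (2 * 1) * t x ^ (2 * (r + 1))))
        * ‖torusFourierInv f x‖ ^ 2 := by
    intro x
    have hs0 : 0 ≤ s x := abs_nonneg _
    have ht0 : 0 ≤ t x := abs_nonneg _
    have hw := one_add_add_pow_two_mul_le r hs0 ht0
    rw [← pow_mul, mul_comm r 2]
    have hWx : 0 ≤ W x := (hWpos x).le
    have hid : W x * (9 ^ r * (1 + s x ^ (2 * r) + t x ^ (2 * r))) =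
        9 ^ r * ((s x ^ (2 * 0) * t x ^ (2 * 0) + s x ^ (2 * 1) * t x ^ (2 * 0) + s x ^ (2 * 0) * t x ^ (2 * 1) + s x ^ (2 * 1) * t x ^ (2 * 1)) +
        (s x ^ (2 * r) * t x ^ (2 * 0) + s x ^ (2 * (r + 1)) * t x ^ (2 * 0) + s x ^ (2 * r) * t x ^ (2 * 1) + s x ^ (2 * (r + 1)) * t x ^ (2 * 1)) +
        (s x ^ (2 * 0) * t x ^ (2 * r) + s x ^ (2 * 1) * t x ^ (2 * r) + s x ^ (2 * 0) * t x ^ (2 * (r + 1)) + s x ^ (2 * 1) * t x ^ (2 * (r + 1)))) := by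
      rw [hW]; ring
    calc W x * ((1 + s x + t x) ^ (2 * r) * ‖torusFourierInv f x‖ ^ 2)
        = (W x * (1 + s x + t x) ^ (2 * r)) * ‖torusFourierInv f x‖ ^ 2 := by ring
      _ ≤ (W x * (9 ^ r * (1 + s x ^ (2 * r) + t x ^ (2 * r)))) * ‖torusFourierInv f x‖ ^ 2 :=
          mul_le_mul_of_nonneg_right (mul_le_mul_of_nonneg_left hw hWx) (sq_nonneg _)
      _ = _ := by rw [hid]
  have hsq : ∑ x, W x * (((1 + s x + t x) ^ r) ^ 2 * ‖torusFourierInv f x‖ ^ 2) ≤ 9 ^ r * (12 * J ^ 2) := by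
    refine (sum_le_sum fun x _ => hexp x).trans ?_
    have hr0 : r ≤ r + 2 := by omega
    have e00 := hM 0 0 (by omega); have e10 := hM 1 0 (by omega); have e01 := hM 0 1 (by omega); have e11 := hM 1 1 (by omega)
    have er0 := hM r 0 (by omega); have es0 := hM (r + 1) 0 (by omega); have er1 := hM r 1 (by omega); have es1 := hM (r + 1) 1 (by omega)
    have e0r := hM 0 r (by omega); have e1r := hM 1 r (by omega); have e0s := hM 0 (r + 1) (by omega); have e1s := hM 1 (r + 1) (by omega)
    have h9 : (0 : ℝ) ≤ 9 ^ r := by positivity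
    simp only [add_mul, mul_add, sum_add_distrib, ← mul_sum, mul_assoc] at *
    linarith [mul_le_mul_of_nonneg_left e00 h9, mul_le_mul_of_nonneg_left e10 h9, mul_le_mul_of_nonneg_left e01 h9,
      mul_le_mul_of_nonneg_left e11 h9, mul_le_mul_of_nonneg_left er0 h9, mul_le_mul_of_nonneg_left es0 h9,
      mul_le_mul_of_nonneg_left er1 h9, mul_le_mul_of_nonneg_left es1 h9, mul_le_mul_of_nonneg_left e0r h9,
      mul_le_mul_of_nonneg_left e1r h9, mul_le_mul_of_nonneg_left e0s h9, mul_le_mul_of_nonneg_left e1s h9]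
  -- conclude
  have h36 : Real.sqrt (∑ x, (W x)⁻¹) ≤ 6 := by
    rw [show (6 : ℝ) = Real.sqrt 36 by rw [show (36 : ℝ) = 6 ^ 2 by norm_num, Real.sqrt_sq (by norm_num)]]
    exact Real.sqrt_le_sqrt hWinv
  have hB : Real.sqrt (∑ x, W x * (((1 + s x + t x) ^ r) ^ 2 * ‖torusFourierInv f x‖ ^ 2)) ≤ Real.sqrt 12 * 3 ^ r * J := by
    refine (Real.sqrt_le_sqrt hsq).trans (le_of_eq ?_)
    rw [show (9 : ℝ) ^ r * (12 * J ^ 2) = (Real.sqrt 12 * 3 ^ r * J) ^ 2 by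
      rw [mul_pow, mul_pow, Real.sq_sqrt (by norm_num), ← pow_mul, mul_comm r 2, pow_mul]; norm_num; ring]
    exact Real.sqrt_sq (by positivity)
  have h12 : Real.sqrt 12 ≤ 7 / 2 := by
    rw [show (7 / 2 : ℝ) = Real.sqrt ((7 / 2) ^ 2) by rw [Real.sqrt_sq (by norm_num)]]
    exact Real.sqrt_le_sqrt (by norm_num)
  calc ∑ x, (1 + s x + t x) ^ r * ‖torusFourierInv f x‖
      ≤ Real.sqrt (∑ x, (W x)⁻¹) * Real.sqrt (∑ x, W x * (((1 + s x + t x) ^ r) ^ 2 * ‖torusFourierInv f x‖ ^ 2)) := hCS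
    _ ≤ 6 * (Real.sqrt 12 * 3 ^ r * J) := mul_le_mul h36 hB (Real.sqrt_nonneg _) (by norm_num)
    _ ≤ 6 * ((7 / 2) * 3 ^ r * J) := by gcongr
    _ = 21 * 3 ^ r * J := by ring

end Literature.Probability.LatticeModels

end
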